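import Literature.AlgebraicGeometry.Frobenioids.BaseSectionsOfObjects
import HarnessLib

/-!
# Frobenioids I, §5: Proposition 5.6 — the restricted pair exists (proof of `Prop56_exists`)

Mochizuki, *The geometry of Frobenioids I: the general theory*, Kyushu J. Math. **62** (2008)
293–400, §5, Proposition 5.6 p. 105 [cite: MochizukiFrdI2008, Prop. 5.6 p.105].

The elementary half of "the pair `(σ, φ)` … determined by 'restricting' `P`, `F` to `A`": for a
base-Frobenius pair `(P, F)` of `C` (Def. 2.7) and `A ∈ Ob(P)`, the equivalence `P ↪ C → D`
(Def. 2.7 (i)(c)) is fully faithful, so every automorphism of `A_D` lifts uniquely to a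
`P`-distinguished automorphism of `A` — this is `σ` — and `φ(n) := F(n)_A`. We construct both and
prove `PreFrobenioid.Prop56_exists` (file `BaseSectionsOfObjects.lean`). No new statements.
-/

namespace Literature.AlgebraicGeometry.Frobenioids

open CategoryTheory Opposite

universe w v v' u u'

namespace PreFrobenioid

variable {D : Type u} [Category.{v} D] {Φ : Dᵒᵖ ⥤ CommMonCat.{w}}
  {C : Type u'} [Category.{v'} C] (F : C ⥤ ElemFrobenioid Φ)

/-- For a base-section `P` and `A ∈ Ob(P)`: the section `σ : Aut_D(A_D) → Aut_C(A)` obtained by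
inverting the bijection `Aut_P(A) ⥲ Aut_D(A_D)` of the (fully faithful) equivalence `P → D`
(Prop. 5.6 p. 105, "restricting `P` … to `A`"). [cite: MochizukiFrdI2008, Prop. 5.6 p.105] -/
noncomputable def restrictSection (P : Presection C) (hP : IsBaseSection F P) {A : C} (hA : P.obj A) :
    Aut (baseObj F A) →* Aut A :=
  haveI := hP.isEquivalence
  let X : P.Cat := ⟨A, hA⟩
  { toFun := fun α => P.ι.mapIso ((P.toBase F).preimageIso (X := X) (Y := X) α)
    map_one' := by
      apply Iso.ext
      change P.ι.map ((P.toBase F).preimage (𝟙 ((P.toBase F).obj X))) = 𝟙 A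
      rw [Functor.preimage_id]
      rfl
    map_mul' := fun α β => by
      apply Iso.ext
      change P.ι.map _ = P.ι.map _ ≫ P.ι.map _
      rw [← P.ι.map_comp]
      congr 1
      apply (P.toBase F).map_injective
      rw [Functor.map_comp, Functor.preimageIso_hom, Functor.preimageIso_hom,
        Functor.preimageIso_hom, Functor.map_preimage, Functor.map_preimage, Functor.map_preimage]
      rfl }

/-- The restriction `φ : N_{≥1} → End_C(A)`, `n ↦ F(n)_A`, of a Frobenius-section to `A ∈ Ob(P)`
(Prop. 5.6 p. 105). [cite: MochizukiFrdI2008, Prop. 5.6 p.105] -/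
def restrictFrobenius (P : Presection C) (Fr : ℕ+ →* End P.ι) {A : C} (hA : P.obj A) :
    ℕ+ →* End A where
  toFun n := (Fr n).app ⟨A, hA⟩
  map_one' := by rw [map_one]; rfl
  map_mul' m n := by rw [map_mul]; rfl

/-- **Proposition 5.6, existence of the restricted pair** (PROVED): `(restrictSection, restrictFrobenius)`
is the pair determined by restricting `(P, F)` to `A` — `σ` is a section of `Aut_C(A) → Aut_D(A_D)`
with `P`-distinguished values and `φ(n) = F(n)_A`. [cite: MochizukiFrdI2008, Prop. 5.6 p.105] -/
theorem isRestrictedPair_restrict (P : Presection C) (Fr : ℕ+ →* End P.ι)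
    (hP : IsBaseFrobeniusPair F P Fr) {A : C} (hA : P.obj A) :
    IsRestrictedPair F P Fr A (restrictSection F P hP.isBaseSection hA) (restrictFrobenius P Fr hA) := by
  haveI := hP.isBaseSection.isEquivalence
  let X : P.Cat := ⟨A, hA⟩
  refine ⟨hA, ?_, ?_, fun n => rfl⟩
  · intro α
    apply Iso.ext
    change (P.toBase F).map ((P.toBase F).preimage (X := X) (Y := X) α.hom) = α.hom
    rw [Functor.map_preimage]
  · intro α
    exact ((P.toBase F).preimageIso (X := X) (Y := X) α).hom.2

/-- **`Prop56_exists` holds** (PROVED): for every base-Frobenius pair `(P, F)` of a Frobenioid `C` and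
every `A ∈ Ob(P)` the restricted pair `(σ, φ)` exists. [cite: MochizukiFrdI2008, Prop. 5.6 p.105] -/
theorem prop56_exists : Prop56_exists F :=
  fun _ P Fr hP _ hA =>
    ⟨restrictSection F P hP.isBaseSection hA, restrictFrobenius P Fr hA,
      isRestrictedPair_restrict F P Fr hP hA⟩

/-- `Prop56_exists` holds for all parameters — `_holds` alias of `prop56_exists` above (appended
2026-08-28, D-0026 bookkeeping: the proof term is the existing theorem of this file; no
statement, definition or attribute is edited; no new named fact).
[cite: MochizukiFrdI2008, Prop. 5.6 p.105] -/
theorem Prop56_exists_holds : Prop56_exists F :=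
  prop56_exists F

end PreFrobenioid

end Literature.AlgebraicGeometry.Frobenioids
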